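import Literature.Topology.FourManifolds.HCobordismHandleCount
import Literature.Topology.FourManifolds.MorseEulerCharacteristic
import Literature.Topology.FourManifolds.DisjointSpheresSlab
import Literature.Topology.FourManifolds.CobordismMorseFunctions
import HarnessLib

/-!
# The Morse-homology count of an h-cobordism — discharged

Topic `Literature/Topology/FourManifolds` (fact seat
`provefact-Literature.Topology.FourManifolds.exists-c05a8a61db`, tenure on rung (K1)
`Literature.Topology.FourManifolds.exists_isMorseFunction_two_three_of_isHCobordism` of
`HCobordismHandles.lean`).  This file **discharges** the named fact
`Literature.Topology.FourManifolds.Cobordism.Milnor1965_ncard_criticalSetOfIndex_eq_of_isHCobordism`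
(`HCobordismHandleCount.lean`): *on a smooth h-cobordism between closed manifolds, a Morse
function on the cobordism all of whose critical points have index `k` or `k + 1` has as many
critical points of index `k` as of index `k + 1`* — and closes (K1) over the single rung of
Milnor's proof of the h-cobordism theorem that is still a named fact below it, Thm. 8.1 at one
end (`Literature.Topology.FourManifolds.Cobordism.Milnor1965_exists_isMorseFunction_two_le_index_left`).

**The printed argument** (Milnor, *Lectures on the h-cobordism theorem* (1965)).  By Thm. 4.8
(PDF p. 25) the Morse function may be taken *nice* (self-indexing), with the same critical
points and the same indices; for a nice Morse function on a triad `(W; V, V')`,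
`C_λ = H_λ(W_λ, W_{λ-1})` is free abelian of rank the number of critical points of index `λ`
(end of §3, PDF p. 21; §7, PDF pp. 46–48) and `H_λ(C_*) ≅ H_λ(W, V)` (Thm. 7.4, PDF p. 48), so
that — Hirsch, *Differential Topology* (1976), Ch. 6 §3, Thm. 3.4 (b), the form proved in the
tree as `Literature.Topology.FourManifolds.Cobordism.IsNiceMorseFunction.morseCount`
(`MorseEulerCharacteristic.lean`) — `Σ_λ (-1)^λ #Crit_λ = Σ_λ (-1)^λ rank H_λ(W, V; ℤ)`.  For an
h-cobordism `H_*(W, V) = 0` (first paragraph of the proof of Thm. 7.8, PDF p. 53: *"Since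
`H_*(W, V) = 0` it follows from Theorem 7.4 that the above sequence is exact"*; proved in the
tree as `Literature.Topology.FourManifolds.Cobordism.IsHCobordism.isZero_relativeSingularHomology`,
`HCobordismMorseComplex.lean`), so the alternating count of critical points vanishes; if all
critical points have index `k` or `k + 1` this reads `#Crit_k = #Crit_{k+1}` (Freedman–Quinn
1990, p. 85, in dimension `5`: *"the boundary homomorphism in the chain complex is the identity
matrix"*).

## Contents (everything proved; no named fact is introduced)

* `Literature.Topology.FourManifolds.Cobordism.IsHCobordism.sum_ncard_criticalSetOfIndex_eq_zero_of_isNiceMorseFunction`,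
  `Literature.Topology.FourManifolds.Cobordism.IsHCobordism.sum_ncard_criticalSetOfIndex_eq_zero` —
  on an h-cobordism the alternating Morse count `Σ_{k ≤ n+1} (-1)^k #Crit_k(f)` of a (nice,
  resp. arbitrary) Morse function on the cobordism vanishes;
* `Literature.Topology.FourManifolds.Cobordism.Milnor1965_ncard_criticalSetOfIndex_eq_of_isHCobordism_holds` —
  **the discharge**;
* `Literature.Topology.FourManifolds.exists_isMorseFunction_two_three_of_isHCobordism_of_left` —
  (K1) from Thm. 8.1 at one end alone (Thm. 2.5, Thm. 4.8 and the count supplied by their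
  discharges `Cobordism.exists_isMorseFunction_holds`, `Cobordism.Milnor1965_finalRearrangement_holds`
  and the above).

## References

* J. Milnor, *Lectures on the h-cobordism theorem*, Princeton Univ. Press (1965): end of §3
  (PDF p. 21), Thm. 4.8 (PDF p. 25), §7 (PDF pp. 46–48, Thm. 7.4), proof of Thm. 7.8 ¶1
  (PDF p. 53), proof of Thm. 9.1 (PDF p. 57).  Held: `book:milnornd-lectures-h-cobordism-theorem`.
  [MilnorHCobordism1965]
* M. W. Hirsch, *Differential Topology*, GTM 33 (1976), Ch. 6 §3, Thm. 3.4 (b). [HirschDT1976]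
* M. H. Freedman, F. Quinn, *Topology of 4-manifolds*, Princeton Math. Series 39 (1990), proof
  of Thm. 7.1D, p. 85. [FreedmanQuinnPMS1990]
* R. Kirby, *Akbulut's corks and h-cobordisms of smooth, simply connected 4-manifolds*, Turkish
  J. Math. 20 (1996) 85–93; arXiv:math/9712231, §2. [KirbyCorks1996]
-/

open scoped Manifold ContDiff Topology
open Set Function CategoryTheory Limits

noncomputable section

namespace Literature.Topology.FourManifolds

universe u

/-! ### The alternating Morse count of an h-cobordism vanishes -/

section Count

open Literature.AlgebraicTopology.SingularHomology

variable {n : ℕ} {M N : Type u} [TopologicalSpace M] [T2Space M] [SecondCountableTopology M]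
  [ChartedSpace (EuclideanSpace ℝ (Fin n)) M] [IsManifold (𝓡 n) ∞ M] [CompactSpace M]
  [TopologicalSpace N] [T2Space N] [SecondCountableTopology N]
  [ChartedSpace (EuclideanSpace ℝ (Fin n)) N] [IsManifold (𝓡 n) ∞ N] [CompactSpace N]

/-- **The alternating Morse count of a nice Morse function on an h-cobordism vanishes**:
`Σ_{k ≤ n+1} (-1)^k #Crit_k(g) = Σ_{i ≤ n+1} (-1)^i rank H_i(W, V; ℤ)` (Hirsch 1976, Ch. 6 §3,
Thm. 3.4 (b); Milnor 1965, §7, Thm. 7.4) and `H_*(W, V; ℤ) = 0` on an h-cobordism (Milnor 1965,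
proof of Thm. 7.8, first paragraph).
[cite: MilnorHCobordism1965, Thm. 7.4 (PDF p. 48) and proof of Thm. 7.8 ¶1 (PDF p. 53)]
[cite: HirschDT1976, Ch. 6 §3, Thm. 3.4 (b)] -/
theorem Cobordism.IsHCobordism.sum_ncard_criticalSetOfIndex_eq_zero_of_isNiceMorseFunction
    {c : Cobordism n M N} (hc : c.IsHCobordism) {g : c.W → ℝ} (hg : c.IsNiceMorseFunction g) :
    ∑ k ∈ Finset.range (n + 2),
      (-1 : ℤ) ^ k * ((criticalSetOfIndex (𝓡∂ (n + 1)) g k).ncard : ℤ) = 0 := by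
  rw [← hg.morseCount.2.2]
  refine Finset.sum_eq_zero fun i _ => ?_
  rw [(Cobordism.finite_and_finrank_eq_zero_of_isZero (hc.isZero_relativeSingularHomology i)).2]
  simp

/-- **The alternating Morse count of any Morse function on an h-cobordism vanishes**: by the
final rearrangement theorem (Milnor 1965, Thm. 4.8, the tree's
`Cobordism.Milnor1965_finalRearrangement_holds`) the Morse function may be replaced by a nice
one with the same critical points and the same indices, to which
`Cobordism.IsHCobordism.sum_ncard_criticalSetOfIndex_eq_zero_of_isNiceMorseFunction` applies.
[cite: MilnorHCobordism1965, Thm. 4.8 (PDF p. 25), Thm. 7.4 (PDF p. 48), proof of Thm. 7.8 ¶1 (PDF p. 53)] -/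
theorem Cobordism.IsHCobordism.sum_ncard_criticalSetOfIndex_eq_zero
    {c : Cobordism n M N} (hc : c.IsHCobordism) {f : c.W → ℝ} (hf : c.IsMorseFunction f) :
    ∑ k ∈ Finset.range (n + 2),
      (-1 : ℤ) ^ k * ((criticalSetOfIndex (𝓡∂ (n + 1)) f k).ncard : ℤ) = 0 := by
  obtain ⟨g, hg, hcs, hidx⟩ := Cobordism.Milnor1965_finalRearrangement_holds hf
  have hk : ∀ k, criticalSetOfIndex (𝓡∂ (n + 1)) g k = criticalSetOfIndex (𝓡∂ (n + 1)) f k := by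
    intro k
    ext z
    simp only [mem_criticalSetOfIndex]
    constructor
    · rintro ⟨hz, rfl⟩
      have hzf : z ∈ criticalSet (𝓡∂ (n + 1)) f := by rw [← hcs]; exact hz
      exact ⟨hzf, (hidx z hzf).symm⟩
    · rintro ⟨hz, rfl⟩
      have hzg : z ∈ criticalSet (𝓡∂ (n + 1)) g := by rw [hcs]; exact hz
      exact ⟨hzg, hidx z hz⟩
  rw [← hc.sum_ncard_criticalSetOfIndex_eq_zero_of_isNiceMorseFunction hg]
  exact Finset.sum_congr rfl fun k _ => by rw [hk k]

/-! ### The discharge -/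

/-- **Discharge of `Literature.Topology.FourManifolds.Cobordism.Milnor1965_ncard_criticalSetOfIndex_eq_of_isHCobordism`**
(Milnor 1965: Thm. 4.8, PDF p. 25; end of §3, PDF p. 21; Thm. 7.4, PDF p. 48; proof of Thm. 7.8,
first paragraph, PDF p. 53 — *"Since `H_*(W, V) = 0` it follows from Theorem 7.4 that the above
sequence is exact"*): on an h-cobordism the alternating Morse count of a Morse function on the
cobordism vanishes (`Cobordism.IsHCobordism.sum_ncard_criticalSetOfIndex_eq_zero`); if every
critical point has index `k` or `k + 1`, only the two terms `(-1)^k #Crit_k` and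
`(-1)^{k+1} #Crit_{k+1}` survive (indices `> n + 1` do not occur), whence `#Crit_k = #Crit_{k+1}`.
[cite: MilnorHCobordism1965, Thm. 4.8 (PDF p. 25), Thm. 7.4 (PDF p. 48), proof of Thm. 7.8 ¶1 (PDF p. 53)]
[cite: FreedmanQuinnPMS1990, proof of Thm. 7.1D (p. 85)] -/
theorem Cobordism.Milnor1965_ncard_criticalSetOfIndex_eq_of_isHCobordism_holds :
    Cobordism.Milnor1965_ncard_criticalSetOfIndex_eq_of_isHCobordism.{u} := by
  intro n M N _ _ _ _ _ _ _ _ _ _ _ _ c hc f hf k hind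
  have hsum := hc.sum_ncard_criticalSetOfIndex_eq_zero hf
  -- no critical points of index other than `k`, `k + 1`
  have hempty : ∀ j, j ≠ k → j ≠ k + 1 → criticalSetOfIndex (𝓡∂ (n + 1)) f j = ∅ := by
    intro j hj hj'
    ext z
    simp only [mem_criticalSetOfIndex, mem_empty_iff_false, iff_false, not_and]
    intro hz hzj
    rcases hind z hz with h | h
    · exact hj (hzj.symm.trans h)
    · exact hj' (hzj.symm.trans h)
  have h1 : (-1 : ℤ) ^ k ≠ 0 := pow_ne_zero _ (by norm_num)
  rcases le_or_gt (k + 1) (n + 1) with hk | hk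
  · -- both indices occur in the count: `(-1)^k (#Crit_k - #Crit_{k+1}) = 0`
    rw [Finset.sum_eq_add_of_mem k (k + 1) (Finset.mem_range.2 (by omega))
      (Finset.mem_range.2 (by omega)) (by omega) fun j _ hj => by
        rw [hempty j hj.1 hj.2, ncard_empty, Nat.cast_zero, mul_zero]] at hsum
    have h2 : (-1 : ℤ) ^ k * (((criticalSetOfIndex (𝓡∂ (n + 1)) f k).ncard : ℤ) -
        ((criticalSetOfIndex (𝓡∂ (n + 1)) f (k + 1)).ncard : ℤ)) = 0 := by
      rw [pow_succ] at hsum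
      linear_combination hsum
    have h3 := (mul_eq_zero.mp h2).resolve_left h1
    exact_mod_cast (sub_eq_zero.mp h3)
  · -- `k + 1 > n + 1`: no critical points of index `k + 1`, hence none of index `k` either
    have hK : criticalSetOfIndex (𝓡∂ (n + 1)) f (k + 1) = ∅ :=
      Cobordism.criticalSetOfIndex_eq_empty_of_lt f hk
    rcases le_or_gt k (n + 1) with hk' | hk'
    · rw [Finset.sum_eq_single_of_mem k (Finset.mem_range.2 (by omega)) fun j _ hj => by
        by_cases hj' : j = k + 1
        · subst hj'; rw [hK, ncard_empty, Nat.cast_zero, mul_zero]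
        · rw [hempty j hj hj', ncard_empty, Nat.cast_zero, mul_zero]] at hsum
      have h3 := (mul_eq_zero.mp hsum).resolve_left h1
      rw [hK, ncard_empty]
      exact_mod_cast h3
    · rw [hK, Cobordism.criticalSetOfIndex_eq_empty_of_lt f hk']

end Count

/-! ### (K1) over Thm. 8.1 at one end -/

/-- **(K1) from Thm. 8.1 at one end alone.**  The named fact
`Literature.Topology.FourManifolds.exists_isMorseFunction_two_three_of_isHCobordism` (a smooth
h-cobordism `W⁵` between closed smooth 4-manifolds with `X₁` simply connected carries a Morse
function on the cobordism with index-`2` critical points below `1/2` and index-`3` critical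
points above `1/2` only, as many of each: Freedman–Quinn 1990, proof of Thm. 7.1D; Kirby 1996,
§2) follows from Milnor's Thm. 8.1 at one end of the cobordism
(`Literature.Topology.FourManifolds.Cobordism.Milnor1965_exists_isMorseFunction_two_le_index_left`),
the other leaves of `exists_isMorseFunction_two_three_of_isHCobordism_of_leaves` — Thm. 2.5,
Thm. 4.8 and the count — being the tree's theorems `Cobordism.exists_isMorseFunction_holds`,
`Cobordism.Milnor1965_finalRearrangement_holds` and
`Cobordism.Milnor1965_ncard_criticalSetOfIndex_eq_of_isHCobordism_holds`.
[cite: MilnorHCobordism1965, proof of Thm. 9.1 (PDF p. 57), with Thm. 2.5, Thm. 8.1, Thm. 4.8, Thm. 7.4]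
[cite: FreedmanQuinnPMS1990, proof of Thm. 7.1D (p. 85)] [cite: KirbyCorks1996, §2] -/
theorem exists_isMorseFunction_two_three_of_isHCobordism_of_left
    (h81 : Cobordism.Milnor1965_exists_isMorseFunction_two_le_index_left.{u}) :
    exists_isMorseFunction_two_three_of_isHCobordism.{u} :=
  exists_isMorseFunction_two_three_of_isHCobordism_of_leaves
    (fun {_ _ _} _ _ _ _ => Cobordism.exists_isMorseFunction_holds) h81
    Cobordism.Milnor1965_finalRearrangement_holds
    Cobordism.Milnor1965_ncard_criticalSetOfIndex_eq_of_isHCobordism_holds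

end Literature.Topology.FourManifolds

end
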